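import Literature.AlgebraicGeometry.Frobenioids.Thm49TwinPrimaryExistence
import Literature.AlgebraicGeometry.Frobenioids.TwinPrimaryTransportWeak
import Literature.AlgebraicGeometry.Frobenioids.PerfFactorialPrimePartsWeak
import HarnessLib

/-!
# [FrdI] Theorem 4.9, proof p. 90 ll. 5–27: EXISTENCE of the twin-primary pair of Proposition 4.1 (iii)
# squares at a prime, for Frobenioids with WEAKLY perf-factorial `Φ` — weak twin of
# `Thm49TwinPrimaryExistence.lean`

Mochizuki, *The geometry of Frobenioids I: the general theory*, Kyushu J. Math. **62** (2008)
293–400, §4, proof of Theorem 4.9, kurims text p. 90 ll. 5–27 [cite: MochizukiFrdI2008, Thm. 4.9 p.90]: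
"since `A` is strictly rational, it follows [cf. Definition 4.5, (ii)] that there exist, for each
`𝔭 ∈ Prime(Φ_i(A))`, cartesian commutative diagrams of pre-steps as in Proposition 4.1, (iii), … in which
`α`, `β` are twin-primary with zero divisor in `𝔭` …".

PROOF-ONLY weak twin of the four statements of `Thm49TwinPrimaryExistence.lean` (seat abc-iut-w5-d021; sub-DAG
row `FrdI:Thm4.9/T49-L07`, existence half): the SAME statements with the §4 standing hypothesis "`Φ`
perf-factorial" (Def. 2.4 (i) (a)–(d) as printed) REPLACED by the named weakening `IsPerfFactorialWeak` of
`PerfFactorialWeak.lean` ((a)–(c) verbatim + (d_ord), (d_res); cell finding F-L2d2-1: (d) fails for the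
divisor monoids of the tempered Frobenioids of [EtTh] §3–§5, where [EtTh] Cor. 3.8 (iii) / Prop. 5.3 invoke
[FrdI] Thm. 4.9), and — for the closer in the binders of row L06 — the frozen hypothesis structure
`FrdI.T42.Setting` REPLACED by the clauses the proof uses, as explicit binders (convention Σ2 of the weak
lineage; no twin of `Setting` is declared). Proofs verbatim: the monoid comparison is
`IsPerfFactorialWeak.exists_primePart_of_mul_eq_mul` / `exists_mem_carrier_dvd_of_precsim` /
`mul_dvd_of_forall_common_dvd_eq_one` (`PerfFactorialPrimePartsWeak.lean`, `PerfFactorialWeakCoprime.lean`);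
the Frobenioid lemmas of `Thm49TwinPrimaryLemmas.lean` (`exists_baseEquivalent_of_dvd`,
`cartesian_of_invDiv_eq_mul`, `div_eq_pull_of_comp_eq`, `primeFree_of_not_exists_precsim`) and the birational
germ calculus are hypothesis-free and consumed BY NAME; the transport is
`FrdI.T49.isTwinPrimary_map_of_coprimary_squares_weak` (`TwinPrimaryTransportWeak.lean`); (d) itself is never
used. Names = strong names + `_weak`. The printed (strong) case is recovered through `IsPerfFactorial.weak`
(and the fields of a `T42.Setting`). Cell abc-iut, layer L1, seat abc-iut-L1-t11 (block T1 of the [FrdI]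
Thm. 4.9 / Cor. 4.11 (iii)(iv) weak programme, split with seat abc-iut-L1-t14; consumer: the weak twin of
`Thm49RightEqLeftAssembly` / `TwinPrimaryCriterion`). No new definitions; nothing printed is restated as if
corrected; nothing here bears on [IUTchIII] Cor. 3.12.

* `PreFrobenioid.exists_twinPrimary_squares_weak` — the seven arrows of the two Prop. 4.1 (iii) squares at
  `𝔭` from base-equivalent pre-steps `δ₁, δ₂ : Y → A` with `x_{δ₁} + b = x_{δ₂} + a`, `𝔭 ∈ Supp(a)`,
  `𝔭 ∉ Supp(b)`;
* `PreFrobenioid.exists_twinPrimary_squares_of_mem_biratSubgroup_weak` — the same from `a − b ∈ Φ^birat(A)`;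
* `PreFrobenioid.exists_twinPrimary_squares_of_isStrictlyRational_weak` — the same from strict rationality
  of `A` (Def. 4.5 (ii)) for any support predicate obeying the support axiom;
* `FrdI.T49.exists_twinPrimary_pair_of_isStrictlyRational_weak` — composed with the transport under `Ψ`:
  twin-primary `(α, β)` at every `𝔭` with `Div(α) ∈ 𝔭`, mapped by `Ψ` to twin-primary steps.
-/

namespace Literature.AlgebraicGeometry.Frobenioids

open CategoryTheory Opposite

universe w v v' u u'

namespace PreFrobenioid

variable {D : Type u} [Category.{v} D] {Φ : Dᵒᵖ ⥤ CommMonCat.{w}}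
  {C : Type u'} [Category.{v'} C] {F : C ⥤ ElemFrobenioid Φ}


/-! ### The existence theorem -/

/-- **[FrdI] proof of Thm. 4.9, p. 90 ll. 5–27 — existence of the twin-primary pair of Proposition 4.1
(iii) squares at `𝔭`.** Frobenioid of perfect and isotropic type, `Φ` WEAKLY perf-factorial; `A ∈ Ob(C)`,
`𝔭 ∈ Prime(Φ(A))`; DATUM (Def. 4.5 (ii) at `𝔭`, read through `Φ^birat(A) =` germs of base-equivalent
pairs): base-equivalent pre-steps `δ₁, δ₂ : Y → A` and `a, b ∈ Φ(A)` with `x_{δ₁} + b = x_{δ₂} + a`,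
some element of `𝔭` dividing `a`, none dividing `b`. CONCLUSION: objects `B, C, D, F` and pre-steps
`α : A → F`, `β : B → A`, `γ : C → B`, `γ' : C → D`, `δ : D → A`, `γ'' : C → A`, `δ' : D → F` with `α`, `β`
primary steps, `δ ∘ γ' = β ∘ γ`, `δ' ∘ γ' = α ∘ γ''`, both squares cartesian among pre-steps, `(δ, β)` and
`(δ', α)` co-primary, `β ∘ γ` and `γ''` Div-equivalent, and `Div(α) ∈ 𝔭` — so that `α`, `β` are
twin-primary with zero divisor in `𝔭` by the converse half (abc-iut-w4-d105). [cite: MochizukiFrdI2008, Thm. 4.9 p.90] -/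
theorem exists_twinPrimary_squares_weak (hF : IsFrobenioid F) (hperf : IsOfPerfectType F)
    (histr : IsOfIsotropicType F) (hpf : Objectwise (fun M _ => IsPerfFactorialWeak M) Φ)
    {Y A : C} {δ₁ δ₂ : Y ⟶ A} (h₁ : IsPreStep F δ₁) (h₂ : IsPreStep F δ₂) (hb : BaseEquivalent F δ₁ δ₂)
    (𝔭 : Primes (Φ.obj (op (baseObj F A)))) {a b : Φ.obj (op (baseObj F A))}
    (hab : invDiv F δ₁ h₁.2 * b = invDiv F δ₂ h₂.2 * a) (ha : ∃ q ∈ 𝔭.carrier, q ∣ a)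
    (hbf : ∀ q ∈ 𝔭.carrier, ¬ q ∣ b) :
    ∃ (B C' D' F' : C) (α : A ⟶ F') (β : B ⟶ A) (γ : C' ⟶ B) (γ' : C' ⟶ D') (δ : D' ⟶ A)
      (γ'' : C' ⟶ A) (δ' : D' ⟶ F'),
      IsStep F α ∧ IsPrimaryPreStep F α ∧ IsStep F β ∧ IsPrimaryPreStep F β ∧
      IsPreStep F γ ∧ IsPreStep F γ' ∧ IsPreStep F δ ∧ IsPreStep F γ'' ∧ IsPreStep F δ' ∧
      γ' ≫ δ = γ ≫ β ∧ γ' ≫ δ' = γ'' ≫ α ∧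
      (∀ ⦃V : C⦄ (a' : V ⟶ D') (b' : V ⟶ B), IsPreStep F a' → IsPreStep F b' → a' ≫ δ = b' ≫ β →
          ∃! u : V ⟶ C', u ≫ γ' = a' ∧ u ≫ γ = b') ∧
      (∀ ⦃V : C⦄ (a' : V ⟶ D') (b' : V ⟶ A), IsPreStep F a' → IsPreStep F b' → a' ≫ δ' = b' ≫ α →
          ∃! u : V ⟶ C', u ≫ γ' = a' ∧ u ≫ γ'' = b') ∧
      (∀ ⦃Z : C⦄ (ζ' : Z ⟶ A), IsPreStep F ζ' →
          (∃ (ε' : D' ⟶ Z) (ι' : B ⟶ Z), IsPreStep F ε' ∧ IsPreStep F ι' ∧ ε' ≫ ζ' = δ ∧ ι' ≫ ζ' = β) →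
            IsIso ζ') ∧
      (∀ ⦃Z : C⦄ (ζ' : Z ⟶ F'), IsPreStep F ζ' →
          (∃ (ε' : D' ⟶ Z) (ι' : A ⟶ Z), IsPreStep F ε' ∧ IsPreStep F ι' ∧ ε' ≫ ζ' = δ' ∧ ι' ≫ ζ' = α) →
            IsIso ζ') ∧
      DivEquivalent F (γ ≫ β) γ'' ∧ Div F α ∈ 𝔭.carrier := by
  have hP := hF.isPreFrobenioid
  have hco : ∀ {X Z : C} {f : X ⟶ Z}, IsPreStep F f → IsCoAngularPreStep F f :=
    fun h => isCoAngularPreStep_of_isotropic histr h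
  have hMA : IsPerfFactorialWeak (Φ.obj (op (baseObj F A))) := hpf (baseObj F A)
  have hperfA : IsPerfect (Φ.obj (op (baseObj F A))) := isPerfect_divisorMonoid hF hperf A
  -- the monoid comparison: `x_{δ₁} = m + p + r`, `x_{δ₂} = m + w`
  obtain ⟨m, p, r, w, hx₁, hx₂, hp, hr, hw⟩ := hMA.exists_primePart_of_mul_eq_mul hperfA 𝔭 hab ha hbf
  have hp1 : p ≠ 1 := hp.1.1
  -- divide out `m`: base-equivalent `ζ, γ'' : C' → A` with `x_ζ = p + r`, `x_{γ''} = w`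
  obtain ⟨C', ζ, γ'', hζ, hγ'', hbζ, hxζ, hxγ''⟩ :=
    exists_baseEquivalent_of_dvd hF histr h₁ h₂ hb m (p * r) w hx₁ hx₂
  -- `β : B → A` realising `p`, `δ : D' → A` realising `r`; factor `ζ` through both
  obtain ⟨B, β, hβco, hxβ⟩ := hF.iii_d_over_surj A p
  obtain ⟨D', δ, hδco, hxδ⟩ := hF.iii_d_over_surj A r
  obtain ⟨γ, hγco, hγ⟩ := hF.iii_d_over_full ζ β (hco hζ) hβco (by rw [hxβ, hxζ]; exact Dvd.intro r rfl)
  obtain ⟨γ', hγ'co, hγ'⟩ := hF.iii_d_over_full ζ δ (hco hζ) hδco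
    (by rw [hxδ, hxζ]; exact Dvd.intro_left p rfl)
  -- `α : A → F'` with `Div α = p`; `δ' : D' → F'` with `δ' ∘ γ' = α ∘ γ''`
  obtain ⟨F', α, hαco, hDα⟩ := hF.iii_d_under_surj A p
  have hDγ' : Div F γ' = pull Φ (Base F ζ) p :=
    div_eq_pull_of_comp_eq hP hγ'co.2 hδco.2 hζ hγ' p (by rw [hxζ, hxδ])
  have hγ''α : IsPreStep F (γ'' ≫ α) := IsPreStep.comp F hγ'' hαco.2
  obtain ⟨δ', hδ'co, hδ'⟩ := hF.iii_d_under_full γ' (γ'' ≫ α) hγ'co (hco hγ''α) (by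
    rw [hDγ', div_comp_of_isLinear γ'' hαco.2.1, hDα, show Base F ζ = Base F γ'' from hbζ]
    exact Dvd.intro _ rfl)
  -- the isomorphisms `Φ(Base ·)` in play
  haveI : IsIso (Base F α) := hαco.2.2
  haveI : IsIso (Base F β) := hβco.2.2
  haveI : IsIso (Base F δ) := hδco.2.2
  haveI : IsIso (Base F δ') := hδ'co.2.2
  haveI : IsIso (Base F γ') := hγ'co.2.2
  haveI : IsIso (Base F ζ) := hζ.2
  haveI : IsCancelMul (Φ.obj (op (baseObj F D'))) :=
    isIntegral_iff_isCancelMul.mp (hP.isDivisorial (baseObj F D')).isPreDivisorial.isIntegral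
  -- `x_α = Φ(α)⁻¹(p)`, `x_{α ∘ γ''} = Φ(α)⁻¹(p + w)`, `Base(δ') = Base(α) ∘ Base(δ)`, `x_{δ'} = Φ(α)⁻¹(w)`
  have hxα : invDiv F α hαco.2.2 = pull Φ (inv (Base F α)) p := by
    show pull Φ (inv (Base F α)) (Div F α) = _
    rw [hDα]
  have hxγ''α : invDiv F (γ'' ≫ α) hγ''α.2 = pull Φ (inv (Base F α)) (p * w) := by
    apply pull_injective (Base F α)
    rw [pull_invDiv_comp F γ'' α hγ''.2 hαco.2 hγ''α.2, hDα, hxγ'', pull_pull_inv_eq]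
  have hBδ' : Base F δ' = Base F δ ≫ Base F α := by
    apply (cancel_epi (Base F γ')).mp
    rw [← base_comp F γ' δ', hδ', ← Category.assoc, ← base_comp F γ' δ, hγ', base_comp,
      show Base F ζ = Base F γ'' from hbζ]
  have hxδ' : invDiv F δ' hδ'co.2.2 = pull Φ (inv (Base F α)) w := by
    have h1 : pull Φ (Base F δ') (invDiv F (γ' ≫ δ') (hδ' ▸ hγ''α.2)) = Div F δ' * invDiv F γ' hγ'co.2.2 :=
      pull_invDiv_comp F γ' δ' hγ'co.2.2 hδ'co.2 _
    have h2 : invDiv F (γ' ≫ δ') (hδ' ▸ hγ''α.2) = invDiv F (γ'' ≫ α) hγ''α.2 := by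
      congr 1
    have h3 : invDiv F γ' hγ'co.2.2 = pull Φ (Base F δ) p := by
      apply pull_injective (Base F γ')
      rw [pull_invDiv, ← pull_comp, ← base_comp, hγ', hDγ']
    rw [h2, hxγ''α, h3, ← pull_invDiv δ' hδ'co.2.2, hBδ', pull_comp, pull_comp, pull_pull_inv_eq,
      map_mul] at h1
    -- `h1 : Φ(δ)(p) · Φ(δ)(w) = Φ(δ)(Φ(α)(x_{δ'})) · Φ(δ)(p)`
    have h4 : pull Φ (Base F δ) w = pull Φ (Base F δ) (pull Φ (Base F α) (invDiv F δ' hδ'co.2.2)) :=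
      mul_left_cancel (h1.trans (mul_comm _ _))
    have h5 : pull Φ (Base F α) (invDiv F δ' hδ'co.2.2) = w := (pull_injective (Base F δ) h4).symm
    rw [← h5, pull_inv_pull_eq]
  -- co-primarity in the language of monoids: `(r, p)` over `A`, `(Φ(α)⁻¹ w, Φ(α)⁻¹ p)` over `F'`
  have hcopA : ∀ x, x ∣ invDiv F δ hδco.2.2 → x ∣ invDiv F β hβco.2.2 → x = 1 := by
    rw [hxδ, hxβ]
    exact forall_common_dvd_eq_one_of_mem_carrier 𝔭 hp hr
  obtain ⟨e, he⟩ := exists_mulEquiv_pull (Φ := Φ) (inv (Base F α))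
  have hcopF : ∀ x, x ∣ invDiv F δ' hδ'co.2.2 → x ∣ invDiv F α hαco.2.2 → x = 1 := by
    rw [hxδ', hxα, ← he, ← he]
    exact forall_common_dvd_eq_one_map_mulEquiv e (forall_common_dvd_eq_one_of_mem_carrier 𝔭 hp hw)
  have hMF : IsPerfFactorialWeak (Φ.obj (op (baseObj F F'))) := hpf (baseObj F F')
  have hperfF : IsPerfect (Φ.obj (op (baseObj F F'))) := isPerfect_divisorMonoid hF hperf F'
  refine ⟨B, C', D', F', α, β, γ, γ', δ, γ'', δ', ?_, ?_, ?_, ?_, hγco.2, hγ'co.2, hδco.2, hγ'', hδ'co.2,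
    by rw [hγ', hγ], hδ', ?_, ?_, ?_, ?_, ?_, ?_⟩
  · -- `α` is a step: `Div α = p ≠ 0`
    refine ⟨hαco.2, fun hiso => hp1 ?_⟩
    rw [← hDα]
    exact isIsometry_of_isIso F hP α
  · -- `α` is primary
    exact ⟨hαco.2, by rw [hDα]; exact hp.1⟩
  · -- `β` is a step: `x_β = p ≠ 0`
    refine ⟨hβco.2, fun hiso => hp1 ?_⟩
    rw [← hxβ]
    exact invDiv_eq_one_of_isIso hP β hβco.2.2
  · -- `β` is primary: `Div β = Φ(β)(p)`
    refine ⟨hβco.2, ?_⟩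
    rw [← pull_invDiv β hβco.2.2, hxβ]
    exact (isPrimary_pull_iff _ _).mpr hp.1
  · -- square 1 is cartesian among pre-steps: `ζ` realises `x_δ + x_β = r + p`
    exact cartesian_of_invDiv_eq_mul hF histr hδco.2 hβco.2
      (fun c hc₁ hc₂ => hMA.mul_dvd_of_forall_common_dvd_eq_one hperfA hcopA hc₁ hc₂) hζ
      (by rw [hxζ, hxδ, hxβ, mul_comm]) hγ'co.2 hγ' hγ
  · -- square 2 is cartesian among pre-steps: `α ∘ γ''` realises `x_{δ'} + x_α`
    exact cartesian_of_invDiv_eq_mul hF histr hδ'co.2 hαco.2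
      (fun c hc₁ hc₂ => hMF.mul_dvd_of_forall_common_dvd_eq_one hperfF hcopF hc₁ hc₂) hγ''α
      (by rw [hxγ''α, hxδ', hxα, map_mul, mul_comm]) hγ'co.2 hδ' rfl
  · -- `(δ, β)` co-primary
    exact (isCoprimary_iff_forall_dvd hF histr hδco.2 hβco.2).mpr hcopA
  · -- `(δ', α)` co-primary
    exact (isCoprimary_iff_forall_dvd hF histr hδ'co.2 hαco.2).mpr hcopF
  · -- `ζ = β ∘ γ` and `γ''` are base-equivalent, hence Div-equivalent
    show pull Φ (Base F (γ ≫ β)) = pull Φ (Base F γ'')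
    rw [hγ, show Base F ζ = Base F γ'' from hbζ]
  · -- zero divisor of `α` in `𝔭`
    rw [hDα]
    exact hp

/-! ### The same, with the hypothesis literally the clause of Definition 4.5 (ii) for `Φ^birat` -/

/-- **[FrdI] proof of Thm. 4.9, p. 90 ll. 5–27, from the Def. 4.5 (ii) clause at `𝔭`:** if
`a − b ∈ Φ^birat(A)` (`biratSubgroup`, = the `phiBirat` of THE birationalization datum `biratData`) with
some element of `𝔭` dividing `a` and none dividing `b`, then the twin-primary pair of Prop. 4.1 (iii)
squares at `𝔭` of `exists_twinPrimary_squares_weak` exists (the germ reading of `Φ^birat(A)`,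
`mem_biratGerms_of_mem_biratSubfunctor`, supplies the base-equivalent pair `δ₁, δ₂`).
[cite: MochizukiFrdI2008, Thm. 4.9 p.90] -/
theorem exists_twinPrimary_squares_of_mem_biratSubgroup_weak (hF : IsFrobenioid F) (hperf : IsOfPerfectType F)
    (histr : IsOfIsotropicType F) (hpf : Objectwise (fun M _ => IsPerfFactorialWeak M) Φ) (A : C)
    (𝔭 : Primes (Φ.obj (op (baseObj F A)))) {a b : Φ.obj (op (baseObj F A))}
    (hmem : Algebra.GrothendieckGroup.of a / Algebra.GrothendieckGroup.of b ∈ biratSubgroup F (baseObj F A))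
    (ha : ∃ q ∈ 𝔭.carrier, q ∣ a) (hbf : ∀ q ∈ 𝔭.carrier, ¬ q ∣ b) :
    ∃ (B C' D' F' : C) (α : A ⟶ F') (β : B ⟶ A) (γ : C' ⟶ B) (γ' : C' ⟶ D') (δ : D' ⟶ A)
      (γ'' : C' ⟶ A) (δ' : D' ⟶ F'),
      IsStep F α ∧ IsPrimaryPreStep F α ∧ IsStep F β ∧ IsPrimaryPreStep F β ∧
      IsPreStep F γ ∧ IsPreStep F γ' ∧ IsPreStep F δ ∧ IsPreStep F γ'' ∧ IsPreStep F δ' ∧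
      γ' ≫ δ = γ ≫ β ∧ γ' ≫ δ' = γ'' ≫ α ∧
      (∀ ⦃V : C⦄ (a' : V ⟶ D') (b' : V ⟶ B), IsPreStep F a' → IsPreStep F b' → a' ≫ δ = b' ≫ β →
          ∃! u : V ⟶ C', u ≫ γ' = a' ∧ u ≫ γ = b') ∧
      (∀ ⦃V : C⦄ (a' : V ⟶ D') (b' : V ⟶ A), IsPreStep F a' → IsPreStep F b' → a' ≫ δ' = b' ≫ α →
          ∃! u : V ⟶ C', u ≫ γ' = a' ∧ u ≫ γ'' = b') ∧
      (∀ ⦃Z : C⦄ (ζ' : Z ⟶ A), IsPreStep F ζ' →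
          (∃ (ε' : D' ⟶ Z) (ι' : B ⟶ Z), IsPreStep F ε' ∧ IsPreStep F ι' ∧ ε' ≫ ζ' = δ ∧ ι' ≫ ζ' = β) →
            IsIso ζ') ∧
      (∀ ⦃Z : C⦄ (ζ' : Z ⟶ F'), IsPreStep F ζ' →
          (∃ (ε' : D' ⟶ Z) (ι' : A ⟶ Z), IsPreStep F ε' ∧ IsPreStep F ι' ∧ ε' ≫ ζ' = δ' ∧ ι' ≫ ζ' = α) →
            IsIso ζ') ∧
      DivEquivalent F (γ ≫ β) γ'' ∧ Div F α ∈ 𝔭.carrier := by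
  have hP := hF.isPreFrobenioid
  -- the germ reading of `Φ^birat(A)`
  obtain ⟨Y, δ₁, δ₂, hδ₁, hδ₂, hb, hd⟩ := mem_biratGerms_of_mem_biratSubfunctor F hF histr hmem
  -- `of a / of b = of x₁ / of x₂` in `Φ(A)^gp` ⇒ `x₁ · b = x₂ · a` in the integral monoid `Φ(A)`
  have hinj : Function.Injective (Algebra.GrothendieckGroup.of (M := Φ.obj (op (baseObj F A)))) :=
    (hP.isDivisorial (baseObj F A)).isPreDivisorial.isIntegral.injective_of
  have hab : invDiv F δ₁ hδ₁.2.2 * b = invDiv F δ₂ hδ₂.2 * a := by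
    apply hinj
    rw [map_mul, map_mul]
    rw [div_eq_div_iff_mul_eq_mul] at hd
    rw [mul_comm] at hd
    exact hd.symm
  exact exists_twinPrimary_squares_weak hF hperf histr hpf hδ₁.2 hδ₂ hb 𝔭 hab ha hbf

/-- **[FrdI] proof of Thm. 4.9, p. 90 ll. 5–27, from Definition 4.5 (ii) as typed** (`IsStrictlyRational`
of `DivisorMonoidCategoryTheoreticityDefs.lean` at THE birationalization datum `biratData hF hsq`, for any
support predicate `Supp` obeying the support axiom of Def. 2.4 (i)(d): "`𝔭 ∈ Supp(a)` iff some primary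
`a₀` of class `𝔭` is `≼ a`"): a strictly rational object `A` of a Frobenioid of perfect and isotropic type
with `Φ` WEAKLY perf-factorial carries, at every prime `𝔭 ∈ Prime(Φ(A))`, the twin-primary pair of Prop. 4.1 (iii)
squares of `exists_twinPrimary_squares_weak`. [cite: MochizukiFrdI2008, Thm. 4.9 p.90] -/
theorem exists_twinPrimary_squares_of_isStrictlyRational_weak (hF : IsFrobenioid F) (hsq : HasBiratSquares F)
    (hperf : IsOfPerfectType F) (histr : IsOfIsotropicType F)
    (hpf : Objectwise (fun M _ => IsPerfFactorialWeak M) Φ)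
    (Supp : ∀ {X : D}, (PreFrobenioidData.ofFunctor Φ F).Mon X →
      Primes ((PreFrobenioidData.ofFunctor Φ F).Mon X) → Prop)
    (hSupp : ∀ (X : D) (a : Φ.obj (op X)) (𝔭 : Primes (Φ.obj (op X))),
      Supp a 𝔭 ↔ ∃ (a₀ : Φ.obj (op X)) (h₀ : IsPrimary a₀),
        Quotient.mk (primarySetoid _) ⟨a₀, h₀⟩ = 𝔭 ∧ Precsim a₀ a)
    {A : C} (hA : PreFrobenioidData.IsStrictlyRational (biratData hF hsq) Supp A)
    (𝔭 : Primes (Φ.obj (op (baseObj F A)))) :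
    ∃ (B C' D' F' : C) (α : A ⟶ F') (β : B ⟶ A) (γ : C' ⟶ B) (γ' : C' ⟶ D') (δ : D' ⟶ A)
      (γ'' : C' ⟶ A) (δ' : D' ⟶ F'),
      IsStep F α ∧ IsPrimaryPreStep F α ∧ IsStep F β ∧ IsPrimaryPreStep F β ∧
      IsPreStep F γ ∧ IsPreStep F γ' ∧ IsPreStep F δ ∧ IsPreStep F γ'' ∧ IsPreStep F δ' ∧
      γ' ≫ δ = γ ≫ β ∧ γ' ≫ δ' = γ'' ≫ α ∧
      (∀ ⦃V : C⦄ (a' : V ⟶ D') (b' : V ⟶ B), IsPreStep F a' → IsPreStep F b' → a' ≫ δ = b' ≫ β →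
          ∃! u : V ⟶ C', u ≫ γ' = a' ∧ u ≫ γ = b') ∧
      (∀ ⦃V : C⦄ (a' : V ⟶ D') (b' : V ⟶ A), IsPreStep F a' → IsPreStep F b' → a' ≫ δ' = b' ≫ α →
          ∃! u : V ⟶ C', u ≫ γ' = a' ∧ u ≫ γ'' = b') ∧
      (∀ ⦃Z : C⦄ (ζ' : Z ⟶ A), IsPreStep F ζ' →
          (∃ (ε' : D' ⟶ Z) (ι' : B ⟶ Z), IsPreStep F ε' ∧ IsPreStep F ι' ∧ ε' ≫ ζ' = δ ∧ ι' ≫ ζ' = β) →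
            IsIso ζ') ∧
      (∀ ⦃Z : C⦄ (ζ' : Z ⟶ F'), IsPreStep F ζ' →
          (∃ (ε' : D' ⟶ Z) (ι' : A ⟶ Z), IsPreStep F ε' ∧ IsPreStep F ι' ∧ ε' ≫ ζ' = δ' ∧ ι' ≫ ζ' = α) →
            IsIso ζ') ∧
      DivEquivalent F (γ ≫ β) γ'' ∧ Div F α ∈ 𝔭.carrier := by
  obtain ⟨a, b, hmem, hSa, hSb⟩ := hA 𝔭
  have hMA : IsPerfFactorialWeak (Φ.obj (op (baseObj F A))) := hpf (baseObj F A)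
  have hperfA : IsPerfect (Φ.obj (op (baseObj F A))) := isPerfect_divisorMonoid hF hperf A
  obtain ⟨a₀, h₀, h𝔭, hpre⟩ := (hSupp _ a 𝔭).mp hSa
  have ha : ∃ q ∈ 𝔭.carrier, q ∣ a := hMA.exists_mem_carrier_dvd_of_precsim hperfA 𝔭 ⟨h₀, h𝔭⟩ hpre
  have hbf : ∀ q ∈ 𝔭.carrier, ¬ q ∣ b :=
    primeFree_of_not_exists_precsim 𝔭 fun h => hSb ((hSupp _ b 𝔭).mpr h)
  exact exists_twinPrimary_squares_of_mem_biratSubgroup_weak hF hperf histr hpf A 𝔭 hmem ha hbf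

end PreFrobenioid

/-! ### In the binders of row L06 (`TwinPrimaryCriterion`): existence composed with the transport under `Ψ` -/

namespace FrdI.T49

variable {D₁ : Type u} [Category.{v} D₁] {Φ₁ : D₁ᵒᵖ ⥤ CommMonCat.{w}} {C₁ : Type u'} [Category.{v'} C₁]
  {D₂ : Type u} [Category.{v} D₂] {Φ₂ : D₂ᵒᵖ ⥤ CommMonCat.{w}} {C₂ : Type u'} [Category.{v'} C₂]
  {F₁ : C₁ ⥤ ElemFrobenioid Φ₁} {F₂ : C₂ ⥤ ElemFrobenioid Φ₂} {Ψ : C₁ ≌ C₂}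

/-- **[FrdI] proof of Thm. 4.9, p. 90 ll. 5–53 at a strictly rational object**: for Frobenioids `C_i` of
perfect and isotropic type with WEAKLY perf-factorial `Φ_i` and `Ψ`/`Ψ⁻¹` preserving pre-steps, `Ψ`
preserving steps (the clauses of `T42.Setting` the proof uses, as explicit binders — convention Σ2),
with `Ψ` preserving primary pre-steps (Thm. 4.2 (i)) and Div-equivalent
pairs of base-isomorphisms (Thm. 4.2 (ii); `Φ_i` non-dilating), a STRICTLY RATIONAL object `A` of `C₁`
(Def. 4.5 (ii) at THE birationalization of `F₁`, any support predicate obeying the support axiom) admits,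
"for each `𝔭 ∈ Prime(Φ₁(A))`, … twin-primary steps with zero divisor in `𝔭` that are mapped by `Ψ` to
twin-primary steps of `C₂`" — existence (this file) composed with the transport
`isTwinPrimary_map_of_coprimary_squares_weak` (`TwinPrimaryTransportWeak.lean`); the output is literally the last hypothesis
of `FrdI.T49.TwinPrimaryCriterion`. [cite: MochizukiFrdI2008, Thm. 4.9 p.90] -/
theorem exists_twinPrimary_pair_of_isStrictlyRational_weak
    (hF₁ : PreFrobenioid.IsFrobenioid F₁) (hF₂ : PreFrobenioid.IsFrobenioid F₂)
    (hperf₁ : PreFrobenioid.IsOfPerfectType F₁) (hperf₂ : PreFrobenioid.IsOfPerfectType F₂)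
    (histr₁ : PreFrobenioid.IsOfIsotropicType F₁) (histr₂ : PreFrobenioid.IsOfIsotropicType F₂)
    (hpf₁ : Objectwise (fun M _ => IsPerfFactorialWeak M) Φ₁)
    (hpf₂ : Objectwise (fun M _ => IsPerfFactorialWeak M) Φ₂)
    (hpre : ∀ ⦃X Y : C₁⦄ (φ : X ⟶ Y),
      PreFrobenioid.IsPreStep F₁ φ → PreFrobenioid.IsPreStep F₂ (Ψ.functor.map φ))
    (hpre' : ∀ ⦃X Y : C₂⦄ (φ : X ⟶ Y),
      PreFrobenioid.IsPreStep F₂ φ → PreFrobenioid.IsPreStep F₁ (Ψ.inverse.map φ))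
    (hstep : ∀ ⦃X Y : C₁⦄ (φ : X ⟶ Y),
      PreFrobenioid.IsStep F₁ φ → PreFrobenioid.IsStep F₂ (Ψ.functor.map φ))
    (hprim : ∀ ⦃X Y : C₁⦄ (φ : X ⟶ Y), PreFrobenioid.IsPrimaryPreStep F₁ φ →
      PreFrobenioid.IsPrimaryPreStep F₂ (Ψ.functor.map φ))
    (hdiveq : ∀ ⦃X Y : C₁⦄ (φ ψ : X ⟶ Y), PreFrobenioid.IsBaseIso F₁ φ → PreFrobenioid.IsBaseIso F₁ ψ →
      PreFrobenioid.DivEquivalent F₁ φ ψ →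
        PreFrobenioid.DivEquivalent F₂ (Ψ.functor.map φ) (Ψ.functor.map ψ))
    (hsq : PreFrobenioid.HasBiratSquares F₁)
    (Supp : ∀ {X : D₁}, (PreFrobenioidData.ofFunctor Φ₁ F₁).Mon X →
      Primes ((PreFrobenioidData.ofFunctor Φ₁ F₁).Mon X) → Prop)
    (hSupp : ∀ (X : D₁) (a : Φ₁.obj (op X)) (𝔭 : Primes (Φ₁.obj (op X))),
      Supp a 𝔭 ↔ ∃ (a₀ : Φ₁.obj (op X)) (h₀ : IsPrimary a₀),
        Quotient.mk (primarySetoid _) ⟨a₀, h₀⟩ = 𝔭 ∧ Precsim a₀ a)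
    {A : C₁} (hA : PreFrobenioidData.IsStrictlyRational (PreFrobenioid.biratData hF₁ hsq) Supp A)
    (𝔭 : Primes (Φ₁.obj (op (PreFrobenioid.baseObj F₁ A)))) :
    ∃ (B C' : C₁) (β : A ⟶ B) (γ : C' ⟶ A), IsTwinPrimary F₁ β γ ∧
      PreFrobenioid.Div F₁ β ∈ 𝔭.carrier ∧ IsTwinPrimary F₂ (Ψ.functor.map β) (Ψ.functor.map γ) := by
  obtain ⟨B, C', D', F', α, β, γ, γ', δ, γ'', δ', hα, hαp, hβ, hβp, hγ, hγ', hδ, hγ'', hδ', sq₁, sq₂,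
    cart₁, cart₂, cop₁, cop₂, hde, hDα⟩ :=
    PreFrobenioid.exists_twinPrimary_squares_of_isStrictlyRational_weak hF₁ hsq hperf₁
      histr₁ hpf₁ Supp hSupp hA 𝔭
  obtain ⟨h₁, h₂⟩ := isTwinPrimary_map_of_coprimary_squares_weak F₁ F₂ Ψ hF₁ hF₂ hperf₁ hperf₂ histr₁ histr₂
    hpf₁ hpf₂ hpre hpre' hstep hprim hdiveq α β γ γ' δ γ'' δ'
    hα hαp hβ hβp hγ hγ' hδ hγ'' hδ' sq₁ sq₂ cart₁ cart₂ cop₁ cop₂ hde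
  exact ⟨F', B, α, β, h₁, hDα, h₂⟩

end FrdI.T49

end Literature.AlgebraicGeometry.Frobenioids
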